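import Literature.AlgebraicTopology.SingularHomology.DualComplexFiniteness
import Literature.AlgebraicTopology.SingularHomology.CompactManifoldFiniteness
import Literature.AlgebraicTopology.SingularHomology.SingularCochains
import Literature.AlgebraicTopology.SingularHomology.SingularChainsConcrete
import Literature.LinearAlgebra.FreeModule.SubmodulePID
import HarnessLib

/-!
# Singular cohomology is finitely generated when singular homology is (Hatcher Cor. 3.3), and
the cohomology of compact manifolds (discharge of `finite_singularCohomology_of_compactSpace` over a PID)

A. Hatcher, *Algebraic Topology* (2002), §3.1, Cor. 3.3 (p. 196) computes `Hⁿ(C; ℤ)` from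
finitely generated `Hₙ(C)`, `Hₙ₋₁(C)` for a chain complex of free abelian groups; in particular
`Hⁿ(X; ℤ)` is finitely generated when `Hₙ(X; ℤ)` and `Hₙ₋₁(X; ℤ)` are. We prove this finiteness
statement for the tree's singular cohomology `Literature.AlgebraicTopology.SingularHomology.singularCohomology R N X n`
(function cochains, `…SingularCochains`) over any principal ideal domain `R` with coefficients in a
finitely generated `R`-module `N`:

* `Literature.AlgebraicTopology.SingularHomology.cochainEquiv`: `Cᵏ(X; N) = (SingularSimplex X k → N) ≃ₗ Hom_R(Cₖ(X; R), N)` with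
  `Cₖ(X; R) = (SingularSimplex X k →₀ R)` the concrete chains of `…SingularChainsConcrete`
  (Mathlib's `Finsupp.llift`; Hatcher §3.1 "`Cⁿ(X; G) = Hom(Cₙ(X), G)`"), intertwining the
  coboundary with precomposition by the boundary (`cochainEquiv_d`: `ε(δφ) = ε(φ) ∘ ∂`).
  (Compare `evalChain_d` of `…UniversalCoefficientsProofs`: the `R`-valued linear extension of a
  cochain to Mathlib's abstract chains; here we need the extension as a linear *equivalence* in
  `φ`, with values in a coefficient module `N`, onto the dual of the concrete complex, whose
  chain modules are syntactically the free modules `SingularSimplex X k →₀ R`.)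
* `Literature.AlgebraicTopology.SingularHomology.exists_fg_cycles_csingular`: finitely generated `Hₖ(X; R)` read on the concrete complex
  (through `csingularHomology.compIso` and `HomologicalComplex.homologyIsoSc'`): cycles are
  finitely generated modulo boundaries;
* `Literature.AlgebraicTopology.SingularHomology.finite_singularCohomology_of_finite_singularHomology` (**Cor. 3.3, finiteness**): by
  `exists_fg_ker_lcomp_le` of `…DualComplexFiniteness` applied to
  `Cₙ₊₁ → Cₙ → Cₙ₋₁ → Cₙ₋₂` (free modules over the PID `R`, so the boundaries are projective by
  `Submodule.projective_of_isPrincipalIdealRing`, Hungerford IV.6.1 as vendored in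
  `Literature.LinearAlgebra.FreeModule.SubmodulePID`), transported to the cochain complex
  (`exists_fg_ker_le_of_equiv`, `ShortComplex.moduleCat_finite_homology_of_exists`); degree `0`
  separately with `C₋₁ = C₋₂ = 0`;
* `Literature.AlgebraicTopology.SingularHomology.finite_singularCohomology_of_compactSpace_of_isPrincipalIdealRing`: **discharge, over
  principal ideal domains, of the named fact** `finite_singularCohomology_of_compactSpace R X n k`
  of `…PoincareDuality` (Hatcher App. A Cor. A.8–A.9 with §3.1 Thm. 3.2 / Cor. 3.3): combine with
  `finite_singularHomology_of_compact_chartedSpace` of `…CompactManifoldFiniteness`. (The named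
  fact is stated for all Noetherian `R`; the general case needs the homotopy-finiteness of compact
  manifolds and is not attempted here.)

## References

* A. Hatcher, *Algebraic Topology*, CUP 2002, §3.1, Thm. 3.2 (p. 195), Cor. 3.3 (p. 196), and
  Appendix A, Cor. A.8–A.9 (p. 527). [HatcherAT2002]
* T. W. Hungerford, *Algebra*, GTM 73, Springer 1974, Thm. IV.6.1 (via `…SubmodulePID`).
-/

noncomputable section

open CategoryTheory Limits

universe u v

namespace Literature.AlgebraicTopology.SingularHomology

section CochainDual

-- as in `SingularChainsConcrete`: chains of the concrete complex are `Finsupp`s up to unfolding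
set_option backward.isDefEq.respectTransparency false

variable (R : Type v) [CommRing R] (N : Type v) [AddCommGroup N] [Module R N]
variable {X : Type u} [TopologicalSpace X]

/-- The `k`-cochains of the tree's cochain complex as honest functions `SingularSimplex X k → N`:
the identity as a linear equivalence (it only fixes the syntactic form of the type; Hatcher 2002,
§3.1, "cochains are functions on simplices"). [folklore] -/
def cochainFun (k : ℕ) : (singularCochainComplex R N X).X k ≃ₗ[R] (SingularSimplex X k → N) :=
  LinearEquiv.refl R _

variable {R N} in
/-- The coboundary read through `cochainFun`: `(δφ)(σ) = ∑ᵢ (-1)ⁱ φ(σ ∘ δᵢ)` (Hatcher 2002, §3.1;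
this is `singularCochainComplex.d_apply`). [cite: HatcherAT2002, §3.1 p. 191] -/
lemma cochainFun_d (k : ℕ) (φ : (singularCochainComplex R N X).X k)
    (σ : SingularSimplex X (k + 1)) :
    cochainFun R N (k + 1) ((singularCochainComplex R N X).d k (k + 1) φ) σ =
      ∑ i : Fin (k + 2), ((-1 : R) ^ (i : ℕ)) • cochainFun R N k φ (σ.face i) :=
  singularCochainComplex.d_apply _ σ

/-- **`Cᵏ(X; N) ≃ₗ Hom_R(Cₖ(X; R), N)`**: a function on singular `k`-simplices extends linearly
over the free module `Cₖ(X; R) = (SingularSimplex X k →₀ R)` of concrete chains (Hatcher 2002,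
§3.1, "`Cⁿ(X; G) = Hom(Cₙ(X), G)`"); Mathlib's `Finsupp.llift` after `cochainFun`. [cite: HatcherAT2002, §3.1 p. 191] -/
def cochainEquiv (k : ℕ) : (singularCochainComplex R N X).X k ≃ₗ[R] (CChain R X k →ₗ[R] N) :=
  (cochainFun R N k).trans (Finsupp.llift N R R (SingularSimplex X k))

variable {R N}

/-- `cochainEquiv` on an elementary chain: `ε(φ)(r • σ) = r • φ(σ)`. [folklore] -/
lemma cochainEquiv_single (k : ℕ) (φ : (singularCochainComplex R N X).X k)
    (σ : SingularSimplex X k) (r : R) :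
    cochainEquiv R N k φ (Finsupp.single σ r) = r • cochainFun R N k φ σ := by
  simp [cochainEquiv, Finsupp.llift_apply, Finsupp.lift_apply]

/-- **`cochainEquiv` intertwines the coboundary with the dual of the boundary**:
`ε(δφ) = ε(φ) ∘ ∂` for the concrete boundary `csingularChainComplex.bd` (Hatcher 2002, §3.1,
"`δ` is the dual `∂*`"). [cite: HatcherAT2002, §3.1 p. 191] -/
lemma cochainEquiv_d (k : ℕ) (φ : (singularCochainComplex R N X).X k) :
    cochainEquiv R N (k + 1) ((singularCochainComplex R N X).d k (k + 1) φ) =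
      (cochainEquiv R N k φ) ∘ₗ
        (csingularChainComplex.bd R k : CChain R X (k + 1) →ₗ[R] CChain R X k) := by
  refine Finsupp.lhom_ext fun σ r ↦ ?_
  rw [cochainEquiv_single, cochainFun_d, Finset.smul_sum, LinearMap.comp_apply,
    csingularChainComplex.bd_single, map_sum]
  refine Finset.sum_congr rfl fun i _ ↦ ?_
  rw [map_smul, cochainEquiv_single, smul_comm]

/-- `cochainEquiv_d` with the differential of the concrete chain complex
(`csingularChainComplex.d_eq`): `ε(δφ) = (∂)* (ε φ)` with `(∂)* = LinearMap.lcomp R N ∂`. [folklore] -/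
lemma cochainEquiv_d' (k : ℕ) (φ : (singularCochainComplex R N X).X k) :
    cochainEquiv R N (k + 1) ((singularCochainComplex R N X).d k (k + 1) φ) =
      LinearMap.lcomp R N ((csingularChainComplex R R X).d (k + 1) k).hom
        (cochainEquiv R N k φ) := by
  rw [LinearMap.lcomp_apply', cochainEquiv_d, csingularChainComplex.d_eq]
  rfl

variable (R X) in
/-- **Finitely generated `Hₖ(X; R)`, read on the concrete chain complex**: if `Hₖ(X; R)` is a
finitely generated `R`-module then the cycles `ker (∂ : Cₖ → Cⱼ)` (`j` the next index) are
finitely generated modulo the boundaries `range (∂ : Cₖ₊₁ → Cₖ)` (through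
`csingularHomology.compIso` and `HomologicalComplex.homologyIsoSc'`). [folklore] -/
lemma exists_fg_cycles_csingular (k j : ℕ) (hj : (ComplexShape.down ℕ).next k = j)
    [Module.Finite R (singularHomology R R X k)] :
    ∃ T : Submodule R ((csingularChainComplex R R X).X k), T.FG ∧
      T ≤ LinearMap.ker ((csingularChainComplex R R X).d k j).hom ∧
      LinearMap.ker ((csingularChainComplex R R X).d k j).hom ≤
        T ⊔ LinearMap.range ((csingularChainComplex R R X).d (k + 1) k).hom := by
  set K := csingularChainComplex R R X
  haveI : Module.Finite R (K.homology k) :=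
    Module.Finite.equiv (csingularHomology.compIso R R X k).toLinearEquiv.symm
  haveI : Module.Finite R (K.sc' (k + 1) k j).homology :=
    Module.Finite.equiv (K.homologyIsoSc' (k + 1) k j (ChainComplex.prev ℕ k) hj).toLinearEquiv
  exact ShortComplex.exists_of_moduleCat_finite_homology (K.sc' (k + 1) k j)

/-- From "cocycles finitely generated modulo coboundaries" in degree `n` of the cochain complex to
finite generation of `Hⁿ(X; N)` (`HomologicalComplex.homologyIsoSc'` and
`ShortComplex.moduleCat_finite_homology_of_exists`). [folklore] -/
lemma finite_singularCohomology_of_exists (i n : ℕ) (hi : (ComplexShape.up ℕ).prev n = i)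
    (h : ∃ P : Submodule R ((singularCochainComplex R N X).X n), P.FG ∧
      P ≤ LinearMap.ker ((singularCochainComplex R N X).d n (n + 1)).hom ∧
      LinearMap.ker ((singularCochainComplex R N X).d n (n + 1)).hom ≤
        P ⊔ LinearMap.range ((singularCochainComplex R N X).d i n).hom) :
    Module.Finite R (singularCohomology R N X n) := by
  set L := singularCochainComplex R N X
  haveI : Module.Finite R (L.sc' i n (n + 1)).homology :=
    ShortComplex.moduleCat_finite_homology_of_exists (L.sc' i n (n + 1)) h
  exact Module.Finite.equiv
    (L.homologyIsoSc' i n (n + 1) hi (CochainComplex.next ℕ n)).toLinearEquiv.symm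

/-- **`H⁰(X; N)` is finitely generated when `H₀(X; R)` is** (`R` Noetherian, `N` finitely
generated; Hatcher 2002, §3.1, `H⁰(X; G) = Hom(H₀(X), G)`, p. 198): the dual-complex theorem with
`C₋₁ = C₋₂ = 0`. [cite: HatcherAT2002, §3.1 Cor. 3.3] -/
theorem finite_singularCohomology_zero [IsNoetherianRing R] [Module.Finite R N]
    [Module.Finite R (singularHomology R R X 0)] : Module.Finite R (singularCohomology R N X 0) := by
  obtain ⟨T₁, hT₁⟩ := exists_fg_cycles_csingular R X 0 0 ChainComplex.next_nat_zero
  have hd00 : (csingularChainComplex R R X).d 0 0 = 0 := (csingularChainComplex R R X).shape 0 0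
    (by simp)
  -- the dual-complex theorem with `C₀ = C₋₁ = 0`
  have hA := exists_fg_ker_lcomp_le (N := N) ((csingularChainComplex R R X).d 1 0).hom
    (0 : (csingularChainComplex R R X).X 0 →ₗ[R] PUnit.{v + 1})
    (0 : PUnit.{v + 1} →ₗ[R] PUnit.{v + 1}) (LinearMap.zero_comp _) (LinearMap.zero_comp _)
    ⟨T₁, hT₁.1, by simp, by
      rw [LinearMap.ker_zero]
      refine le_trans ?_ hT₁.2.2
      rw [hd00]; simp⟩
    ⟨⊥, Submodule.fg_bot, bot_le, fun x _ ↦ by simp⟩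
  refine finite_singularCohomology_of_exists 0 0 CochainComplex.prev_nat_zero
    (exists_fg_ker_le_of_equiv _ _ _ _ (cochainEquiv R N 0) (cochainEquiv R N 1)
      (fun φ ↦ cochainEquiv_d' 0 φ) (fun x hx ↦ ?_) hA)
  obtain ⟨θ, hθ⟩ := hx
  have : cochainEquiv R N 0 x = 0 := by
    rw [← hθ, LinearMap.lcomp_apply', LinearMap.comp_zero]
  rw [(cochainEquiv R N 0).map_eq_zero_iff.mp this]
  exact zero_mem _

/-- **`Hʲ⁺¹(X; N)` is finitely generated when `Hⱼ₊₁(X; R)` and `Hⱼ(X; R)` are** (`R` a principal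
ideal domain, `N` finitely generated; the finiteness in Hatcher 2002, §3.1, Cor. 3.3): the
dual-complex theorem for `Cⱼ₊₂ → Cⱼ₊₁ → Cⱼ → C_{next j}`, the boundaries in the free module `Cⱼ₋₁`
being projective (`Submodule.projective_of_isPrincipalIdealRing`), transported along
`cochainEquiv`. [cite: HatcherAT2002, §3.1 Cor. 3.3] -/
theorem finite_singularCohomology_succ [IsDomain R] [IsPrincipalIdealRing R] [Module.Finite R N]
    (j : ℕ) [Module.Finite R (singularHomology R R X (j + 1))]
    [Module.Finite R (singularHomology R R X j)] :
    Module.Finite R (singularCohomology R N X (j + 1)) := by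
  set j' := (ComplexShape.down ℕ).next j
  obtain ⟨T₁, hT₁⟩ := exists_fg_cycles_csingular R X (j + 1) j (ChainComplex.next_nat_succ j)
  obtain ⟨T₀, hT₀⟩ := exists_fg_cycles_csingular R X j j' rfl
  haveI : Module.Free R ((csingularChainComplex R R X).X j') :=
    inferInstanceAs (Module.Free R (CChain R X j'))
  haveI : Module.Projective R (LinearMap.range ((csingularChainComplex R R X).d j j').hom) :=
    Submodule.projective_of_isPrincipalIdealRing _
  have hA := exists_fg_ker_lcomp_le (N := N) ((csingularChainComplex R R X).d (j + 2) (j + 1)).hom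
    ((csingularChainComplex R R X).d (j + 1) j).hom ((csingularChainComplex R R X).d j j').hom
    (by rw [← ModuleCat.hom_comp, (csingularChainComplex R R X).d_comp_d, ModuleCat.hom_zero])
    (by rw [← ModuleCat.hom_comp, (csingularChainComplex R R X).d_comp_d, ModuleCat.hom_zero])
    ⟨T₁, hT₁⟩ ⟨T₀, hT₀⟩
  refine finite_singularCohomology_of_exists j (j + 1) (CochainComplex.prev_nat_succ j)
    (exists_fg_ker_le_of_equiv _ _ _ _ (cochainEquiv R N (j + 1)) (cochainEquiv R N (j + 2))
      (fun φ ↦ cochainEquiv_d' (j + 1) φ) (fun x hx ↦ ?_) hA)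
  obtain ⟨θ, hθ⟩ := hx
  refine ⟨(cochainEquiv R N j).symm θ, (cochainEquiv R N (j + 1)).injective ?_⟩
  rw [cochainEquiv_d' j, LinearEquiv.apply_symm_apply]
  exact hθ

/-- **Singular cohomology is finitely generated when singular homology is** (Hatcher 2002, §3.1,
Cor. 3.3 (p. 196), finiteness part; `R` a principal ideal domain, `N` a finitely generated
`R`-module): if `Hₙ(X; R)` and `Hₙ₋₁(X; R)` are finitely generated then so is `Hⁿ(X; N)`. [cite: HatcherAT2002, §3.1 Cor. 3.3] -/
theorem finite_singularCohomology_of_finite_singularHomology [IsDomain R] [IsPrincipalIdealRing R]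
    [Module.Finite R N] (n : ℕ) [Module.Finite R (singularHomology R R X n)]
    (h : ∀ m, m + 1 = n → Module.Finite R (singularHomology R R X m)) :
    Module.Finite R (singularCohomology R N X n) := by
  cases n with
  | zero => exact finite_singularCohomology_zero
  | succ j =>
    haveI := h j rfl
    exact finite_singularCohomology_succ j

end CochainDual

/-! ### Cohomology of compact manifolds -/

section Manifold

variable (R : Type v) [CommRing R]

/-- **The singular cohomology of a compact manifold is finitely generated** (Hatcher 2002,
App. A, Cor. A.8–A.9 with §3.1, Cor. 3.3): for `X` compact Hausdorff with an atlas modelled on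
`EuclideanSpace ℝ (Fin d)`, `R` a principal ideal domain and `N` a finitely generated `R`-module,
every `Hᵏ(X; N)` is a finitely generated `R`-module (`finite_singularHomology_of_compact_chartedSpace`
and `finite_singularCohomology_of_finite_singularHomology`). [cite: HatcherAT2002, App. A Cor. A.8–A.9 and §3.1 Cor. 3.3] -/
theorem finite_singularCohomology_of_compact_chartedSpace [IsDomain R] [IsPrincipalIdealRing R]
    (N : Type v) [AddCommGroup N] [Module R N] [Module.Finite R N] {X : Type u}
    [TopologicalSpace X] {d : ℕ} [CompactSpace X] [T2Space X]
    [ChartedSpace (EuclideanSpace ℝ (Fin d)) X] (k : ℕ) :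
    Module.Finite R (singularCohomology R N X k) :=
  haveI : ∀ m, Module.Finite R (singularHomology R R X m) := fun m ↦
    finite_singularHomology_of_compact_chartedSpace R R (d := d) m
  finite_singularCohomology_of_finite_singularHomology k fun _ _ ↦ inferInstance

/-- **Discharge, over principal ideal domains, of the named fact
`Literature.AlgebraicTopology.SingularHomology.finite_singularCohomology_of_compactSpace`** (`…PoincareDuality`; Hatcher 2002, App. A,
Cor. A.8 and A.9, p. 527, with the universal coefficient theorem §3.1, Thm. 3.2 / Cor. 3.3): the
cohomology `Hᵏ(X; R)` of a closed topological `n`-manifold is a finitely generated `R`-module.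
The fact is stated for Noetherian `R`; this proves it whenever `R` is a principal ideal domain
(in particular for `ℤ` and for fields). [cite: HatcherAT2002, App. A Cor. A.8–A.9 and §3.1 Cor. 3.3] -/
theorem finite_singularCohomology_of_compactSpace_of_isPrincipalIdealRing [IsDomain R]
    [IsPrincipalIdealRing R] (X : Type u) [TopologicalSpace X] (n : ℕ) [CompactSpace X]
    [T2Space X] [ChartedSpace (EuclideanSpace ℝ (Fin n)) X] (k : ℕ) :
    finite_singularCohomology_of_compactSpace R X n k :=
  finite_singularCohomology_of_compact_chartedSpace R R (d := n) k

end Manifold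

end Literature.AlgebraicTopology.SingularHomology
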